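import Literature.Probability.Percolation.PlateCrossingEvents
import Literature.Probability.Percolation.LatticeTraceBlocking
import Literature.Probability.Percolation.InterfaceLoopPolygon
import Literature.Topology.PlaneTopology.PlusCrossing
import HarnessLib

/-!
# A vertical `𝕋` plate crossing meets every horizontal continuum of the plate; interface arcs block

Topic: Probability / Percolation; proofs only.  The deterministic blocking step of loop-to-crossing
transfer arguments on the triangular lattice (Camia–Newman, Comm. Math. Phys. 268 (2006), §5:
crossings are read off the interface loops; Bollobás–Riordan, *Percolation* (2006), Ch. 7,
Claim 19 p. 192: a horizontal crossing and a vertical crossing of a rectangle meet), in the plate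
vocabulary of `PlateCrossingEvents.lean` (chart `Φ : ℂ ≃ₜ ℂ`, plate `Φ(plateBox x yout)`, zones
`Φ{im ≤ -yin}`, `Φ{yin ≤ im}`, sites drawn by `triMeshPoint δ`):

* `IsSiteInterfaceLoop.segment_disjoint_polyTrace_of_not_mem` — an edge of `δ𝕋` between two
  CLOSED sites misses the polygon `polyTrace δ w` of an interface loop `w` (twin of
  `segment_disjoint_polyTrace_of_mem`: a crossed edge has an open endpoint);
  `IsSiteInterfaceLoop.disjoint_triWalkTrace_polyTrace_of_forall_mem` / `_of_forall_not_mem` —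
  hence the drawn trace of an open walk, resp. of a closed walk, misses the polygon.
* `symm_mem_plateBox_of_mem_triWalkTrace` — **chart room for traces**: if `Φ⁻¹` moves points
  within `ρ` of `Φ(plateBox X Y)` by at most `ν` and `|δ| ≤ ρ`, the trace of a walk whose sites are
  drawn in `Φ(plateBox x yout) ⊆ Φ(plateBox X Y)` pulls back into `plateBox (x + ν) (yout + ν)`.
* `triWalkTrace_inter_nonempty_of_chart` — **a vertical plate walk meets every chart-horizontal
  continuum**: such a walk from `Φ{im ≤ -yin}` to `Φ{yin ≤ im}` meets every compact connected `H`
  whose pull-back lies in the band `|im| ≤ yin` and reaches `re ≤ -(x + ν)` and `x + ν ≤ re`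
  (`inter_nonempty_of_plus_chart`).
* `not_mem_triPlateV_of_chart_continuum` — so a configuration `χ` all of whose `χ`–`χ` edges
  miss `H` has no vertical plate crossing `triPlateV Φ δ x yin yout`;
  `IsSiteInterfaceLoop.not_mem_triMonoPlateV_of_chart_continuum` — in particular a continuum
  `H ⊆ polyTrace δ w` of an interface loop of `ω` in that position excludes every monochromatic
  vertical plate crossing of `ω` (`triMonoPlateV`).

## References

* F. Camia, C. M. Newman, Comm. Math. Phys. 268 (2006), §4–5 [CamiaNewman2006].
* B. Bollobás, O. Riordan, *Percolation*, CUP (2006), Ch. 7, Claim 19 p. 192 [BollobasRiordan2006].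
-/

noncomputable section

namespace Literature.Probability.Percolation

open Set Metric Complex LatticeModels Literature.Topology.PlaneTopology

/-! ### Closed edges and monochromatic walks miss the interface polygons -/

section Interface

variable {ω : SiteConfig (Site 2)} {f₀ : HexVertex} {w : hexGraph.Walk f₀ f₀}
  (hw : IsSiteInterfaceLoop ω w) {δ : ℝ}

include hw

/-- **An edge of `δ𝕋` between two closed sites (or a closed lattice point) misses the trace**: a
crossed edge has an open endpoint (Camia–Newman 2006, §4: the interface runs between an open and
a closed hexagon). [cite: CamiaNewman2006, §4] -/
theorem IsSiteInterfaceLoop.segment_disjoint_polyTrace_of_not_mem (hδ : 0 < δ) {a b : Site 2}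
    (hab : a = b ∨ triGraph.Adj a b) (ha : a ∉ ω) (hb : b ∉ ω) :
    Disjoint (segment ℝ (triMeshPoint δ a) (triMeshPoint δ b)) (polyTrace δ w) := by
  refine disjoint_left.2 fun q hq1 hq ↦ ?_
  obtain ⟨i, hi, hq2⟩ := mem_polyTrace_iff.1 hq
  rcases hw.eq_lv_rv_of_inter hδ hab hi hq1 hq2 with ⟨-, h2⟩ | ⟨h1, -⟩
  · exact hb (h2 ▸ hw.lv_mem hi)
  · exact ha (h1 ▸ hw.lv_mem hi)

/-- **The trace of an open `𝕋`-walk misses every interface polygon** (edge by edge,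
`segment_disjoint_polyTrace_of_mem`). [cite: CamiaNewman2006, §4] -/
theorem IsSiteInterfaceLoop.disjoint_triWalkTrace_polyTrace_of_forall_mem (hδ : 0 < δ) {u v : Site 2}
    {π : triGraph.Walk u v} (hπ : ∀ z ∈ π.support, z ∈ ω) :
    Disjoint (triWalkTrace δ π) (polyTrace δ w) := by
  refine disjoint_left.2 fun p hp hp' ↦ ?_
  obtain ⟨e, he, hpe⟩ := mem_triWalkTrace_iff.1 hp
  revert he hpe
  induction e using Sym2.ind with
  | h a b =>
    intro he hpe
    rw [triEdgeSeg_mk] at hpe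
    exact Set.disjoint_left.1 (hw.segment_disjoint_polyTrace_of_mem hδ (Or.inr (π.adj_of_mem_edges he))
      (hπ a (π.fst_mem_support_of_mem_edges he)) (hπ b (π.snd_mem_support_of_mem_edges he))) hpe hp'

/-- **The trace of a closed `𝕋`-walk misses every interface polygon** (edge by edge,
`segment_disjoint_polyTrace_of_not_mem`). [cite: CamiaNewman2006, §4] -/
theorem IsSiteInterfaceLoop.disjoint_triWalkTrace_polyTrace_of_forall_not_mem (hδ : 0 < δ)
    {u v : Site 2} {π : triGraph.Walk u v} (hπ : ∀ z ∈ π.support, z ∉ ω) :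
    Disjoint (triWalkTrace δ π) (polyTrace δ w) := by
  refine disjoint_left.2 fun p hp hp' ↦ ?_
  obtain ⟨e, he, hpe⟩ := mem_triWalkTrace_iff.1 hp
  revert he hpe
  induction e using Sym2.ind with
  | h a b =>
    intro he hpe
    rw [triEdgeSeg_mk] at hpe
    exact Set.disjoint_left.1 (hw.segment_disjoint_polyTrace_of_not_mem hδ
      (Or.inr (π.adj_of_mem_edges he)) (hπ a (π.fst_mem_support_of_mem_edges he))
      (hπ b (π.snd_mem_support_of_mem_edges he))) hpe hp'

end Interface

/-! ### Chart room for drawn traces -/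

/-- Points at distance `≤ ν` have real and imaginary parts within `ν`. [folklore] -/
theorem abs_re_sub_le_and_abs_im_sub_le_of_dist_le {p z : ℂ} {ν : ℝ} (h : dist p z ≤ ν) :
    |p.re - z.re| ≤ ν ∧ |p.im - z.im| ≤ ν := by
  rw [dist_eq_norm] at h
  exact ⟨(sub_re p z ▸ abs_re_le_norm (p - z)).trans h, (sub_im p z ▸ abs_im_le_norm (p - z)).trans h⟩

/-- **Chart room for traces.**  Suppose `Φ⁻¹` moves every point within `ρ` of `Φ z`,
`z ∈ plateBox X Y`, to within `ν` of `z`, and `|δ| ≤ ρ`.  Then the trace of a `𝕋`-walk whose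
sites are drawn (by `triMeshPoint δ`) in `Φ(plateBox x yout)`, `plateBox x yout ⊆ plateBox X Y`,
pulls back into `plateBox (x + ν) (yout + ν)`: every trace point is within one mesh of a drawn
site. [folklore] -/
theorem symm_mem_plateBox_of_mem_triWalkTrace (Φ : ℂ ≃ₜ ℂ) {ν ρ δ x yout X Y : ℝ}
    (hroom : ∀ z ∈ plateBox X Y, ∀ p : ℂ, dist p (Φ z) ≤ ρ → dist (Φ.symm p) z ≤ ν)
    (hδ : |δ| ≤ ρ) (hsub : plateBox x yout ⊆ plateBox X Y) {u v : Site 2} {π : triGraph.Walk u v}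
    (hπ : ∀ z ∈ π.support, triMeshPoint δ z ∈ Φ '' plateBox x yout) {p : ℂ}
    (hp : p ∈ triWalkTrace δ π) : Φ.symm p ∈ plateBox (x + ν) (yout + ν) := by
  obtain ⟨s, hs, hdist⟩ := exists_dist_triMeshPoint_le_of_mem_triWalkTrace hp
  obtain ⟨z, hz, hzs⟩ := hπ s hs
  have hd : dist (Φ.symm p) z ≤ ν := hroom z (hsub hz) p (by rw [hzs]; exact hdist.trans hδ)
  obtain ⟨hre, him⟩ := abs_re_sub_le_and_abs_im_sub_le_of_dist_le hd
  rw [abs_le] at hre him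
  rw [plateBox, mem_reProdIm, mem_Icc, mem_Icc] at hz ⊢
  obtain ⟨⟨hz1, hz2⟩, hz3, hz4⟩ := hz
  exact ⟨⟨by linarith [hre.1], by linarith [hre.2]⟩, by linarith [him.1], by linarith [him.2]⟩

/-! ### A vertical plate walk meets every chart-horizontal continuum -/

/-- **A vertical plate walk on `δ𝕋` meets every chart-horizontal continuum of the band.**  With
chart room `(ν, ρ)` on `plateBox X Y ⊇ plateBox x yout` and `|δ| ≤ ρ`: a `𝕋`-walk with sites
drawn in `Φ(plateBox x yout)` from a site drawn in `Φ{im ≤ -yin}` to one drawn in `Φ{yin ≤ im}`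
(`0 < yin`) meets every compact connected `H` whose pull-back `Φ⁻¹(H)` lies in the band
`-yin ≤ im ≤ yin` and reaches `{re ≤ -(x + ν)}` and `{x + ν ≤ re}` — the drawn trace pulls back
into the strip `|re| ≤ x + ν` and joins the two zones, so the two continua are in plus position
(`inter_nonempty_of_plus_chart`; Bollobás–Riordan 2006, Ch. 7 Claim 19: a vertical and a
horizontal crossing meet). [cite: BollobasRiordan2006, Ch. 7 Claim 19 p. 192] -/
theorem triWalkTrace_inter_nonempty_of_chart (Φ : ℂ ≃ₜ ℂ) {ν ρ δ x yin yout X Y : ℝ}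
    (hroom : ∀ z ∈ plateBox X Y, ∀ p : ℂ, dist p (Φ z) ≤ ρ → dist (Φ.symm p) z ≤ ν)
    (hδ : |δ| ≤ ρ) (hsub : plateBox x yout ⊆ plateBox X Y) (hx : 0 ≤ x + ν) (hyin : 0 < yin)
    {u v : Site 2} (π : triGraph.Walk u v)
    (hπ : ∀ z ∈ π.support, triMeshPoint δ z ∈ Φ '' plateBox x yout)
    (hu : triMeshPoint δ u ∈ Φ '' {z : ℂ | z.im ≤ -yin})
    (hv : triMeshPoint δ v ∈ Φ '' {z : ℂ | yin ≤ z.im})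
    {H : Set ℂ} (hH : IsCompact H) (hHc : IsPreconnected H)
    (hHband : ∀ p ∈ H, -yin ≤ (Φ.symm p).im ∧ (Φ.symm p).im ≤ yin)
    (hHa : ∃ p ∈ H, (Φ.symm p).re ≤ -(x + ν)) (hHb : ∃ p ∈ H, x + ν ≤ (Φ.symm p).re) :
    (triWalkTrace δ π ∩ H).Nonempty := by
  obtain ⟨z₁, hz₁, h₁⟩ := hu
  obtain ⟨z₂, hz₂, h₂⟩ := hv
  simp only [mem_setOf_eq] at hz₁ hz₂
  have hne : u ≠ v := by
    rintro rfl
    have h12 : z₁ = z₂ := Φ.injective (h₁.trans h₂.symm)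
    rw [h12] at hz₁
    linarith
  have hn : ¬ π.Nil := SimpleGraph.Walk.not_nil_of_ne hne
  refine inter_nonempty_of_plus_chart Φ (a := -(x + ν)) (b := x + ν) (c := -yin) (d := yin)
    (by linarith) (by linarith) (isCompact_triWalkTrace δ π) (isPreconnected_triWalkTrace δ π)
    ?_ ?_ ?_ hH hHc hHband hHa hHb
  · intro p hp
    have h := symm_mem_plateBox_of_mem_triWalkTrace Φ hroom hδ hsub hπ hp
    rw [plateBox, mem_reProdIm, mem_Icc] at h
    exact ⟨by linarith [h.1.1], h.1.2⟩
  · refine ⟨_, triMeshPoint_mem_triWalkTrace hn π.start_mem_support, ?_⟩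
    rw [← h₁, Homeomorph.symm_apply_apply]
    exact hz₁
  · refine ⟨_, triMeshPoint_mem_triWalkTrace hn π.end_mem_support, ?_⟩
    rw [← h₂, Homeomorph.symm_apply_apply]
    exact hz₂

/-- **No vertical plate crossing across a chart-horizontal continuum off the `χ`-edges.**  In the
situation of `triWalkTrace_inter_nonempty_of_chart`, if every drawn edge of `δ𝕋` between two
sites of `χ` misses `H`, then `χ ∉ triPlateV Φ δ x yin yout` (an open plate path would be such a
walk through sites of `χ`, and the common point lies on one of its edges).
[cite: BollobasRiordan2006, Ch. 7 Claim 19 p. 192] -/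
theorem not_mem_triPlateV_of_chart_continuum (Φ : ℂ ≃ₜ ℂ) {ν ρ δ x yin yout X Y : ℝ}
    (hroom : ∀ z ∈ plateBox X Y, ∀ p : ℂ, dist p (Φ z) ≤ ρ → dist (Φ.symm p) z ≤ ν)
    (hδ : |δ| ≤ ρ) (hsub : plateBox x yout ⊆ plateBox X Y) (hx : 0 ≤ x + ν) (hyin : 0 < yin)
    {H : Set ℂ} (hH : IsCompact H) (hHc : IsPreconnected H)
    (hHband : ∀ p ∈ H, -yin ≤ (Φ.symm p).im ∧ (Φ.symm p).im ≤ yin)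
    (hHa : ∃ p ∈ H, (Φ.symm p).re ≤ -(x + ν)) (hHb : ∃ p ∈ H, x + ν ≤ (Φ.symm p).re)
    {χ : SiteConfig (Site 2)}
    (hdisj : ∀ a b : Site 2, triGraph.Adj a b → a ∈ χ → b ∈ χ →
      Disjoint (segment ℝ (triMeshPoint δ a) (triMeshPoint δ b)) H) :
    χ ∉ triPlateV Φ δ x yin yout := by
  rintro ⟨u, hu, v, hv, hconn⟩
  obtain ⟨π, hπ⟩ := (mem_siteConnIn_iff_pathIn.1 hconn).exists_walk
  obtain ⟨p, hp, hpH⟩ := triWalkTrace_inter_nonempty_of_chart Φ hroom hδ hsub hx hyin π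
    (fun z hz ↦ (hπ z hz).1) hu hv hH hHc hHband hHa hHb
  obtain ⟨e, he, hpe⟩ := mem_triWalkTrace_iff.1 hp
  revert he hpe
  induction e using Sym2.ind with
  | h a b =>
    intro he hpe
    rw [triEdgeSeg_mk] at hpe
    exact Set.disjoint_left.1 (hdisj a b (π.adj_of_mem_edges he)
      (hπ a (π.fst_mem_support_of_mem_edges he)).2 (hπ b (π.snd_mem_support_of_mem_edges he)).2)
      hpe hpH

/-- **An interface arc in horizontal position blocks every monochromatic vertical plate crossing.**
Let `w` be an interface loop of `ω` on `δ𝕋` (`0 < δ ≤ ρ`, chart room `(ν, ρ)` on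
`plateBox X Y ⊇ plateBox x yout`) and `H ⊆ polyTrace δ w` a compact connected piece of its polygon
whose pull-back lies in the band `|im| ≤ yin` and reaches `{re ≤ -(x + ν)}` and `{x + ν ≤ re}`.
Then `ω ∉ triMonoPlateV Φ δ x yin yout`: an open (resp. closed) vertical plate path would meet `H`
(`triWalkTrace_inter_nonempty_of_chart`), but open–open and closed–closed edges miss the interface
polygons (Camia–Newman 2006, §4–5). [cite: CamiaNewman2006, §5] -/
theorem IsSiteInterfaceLoop.not_mem_triMonoPlateV_of_chart_continuum {ω : SiteConfig (Site 2)}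
    {f₀ : HexVertex} {w : hexGraph.Walk f₀ f₀} (hw : IsSiteInterfaceLoop ω w) (Φ : ℂ ≃ₜ ℂ)
    {ν ρ δ x yin yout X Y : ℝ}
    (hroom : ∀ z ∈ plateBox X Y, ∀ p : ℂ, dist p (Φ z) ≤ ρ → dist (Φ.symm p) z ≤ ν)
    (hδ0 : 0 < δ) (hδ : δ ≤ ρ) (hsub : plateBox x yout ⊆ plateBox X Y) (hx : 0 ≤ x + ν)
    (hyin : 0 < yin) {H : Set ℂ} (hH : IsCompact H) (hHc : IsPreconnected H)
    (hHw : H ⊆ polyTrace δ w)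
    (hHband : ∀ p ∈ H, -yin ≤ (Φ.symm p).im ∧ (Φ.symm p).im ≤ yin)
    (hHa : ∃ p ∈ H, (Φ.symm p).re ≤ -(x + ν)) (hHb : ∃ p ∈ H, x + ν ≤ (Φ.symm p).re) :
    ω ∉ triMonoPlateV Φ δ x yin yout := by
  have hδ' : |δ| ≤ ρ := by rwa [abs_of_pos hδ0]
  rintro (h | h)
  · exact not_mem_triPlateV_of_chart_continuum Φ hroom hδ' hsub hx hyin hH hHc hHband hHa hHb
      (fun a b hab ha hb ↦ (hw.segment_disjoint_polyTrace_of_mem hδ0 (Or.inr hab) ha hb).mono_right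
        hHw) h
  · exact not_mem_triPlateV_of_chart_continuum Φ hroom hδ' hsub hx hyin hH hHc hHband hHa hHb
      (fun a b hab ha hb ↦ (hw.segment_disjoint_polyTrace_of_not_mem hδ0 (Or.inr hab) ha hb).mono_right
        hHw) h

end Literature.Probability.Percolation

end
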